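import Mathlib

/-!
# Route PlaneEnergyCeiling · crux `PlanarEnergyAPriori` — the logarithmic kernel bound

Helper file for the crux item stmt-NavierStokesRegularity-16855 (`PlanarEnergyAPriori`), landed
`--supports` that item: the one-variable estimate behind the Leray-rate corollary of the dynamic
planar ceiling (strategist census gen 1, A-S6 (S6)(ii), `TypeIEnstrophyLogSqCeiling`): for
`0 < t' < T`,

  `∫_{(0,t')} (t'−s)^{-1/2} (T−s)^{-1/2} ds ≤ 2 + log(T/(T−t'))`

(split at `s = t' − (T−t')`: near `t'` use `T − s ≥ T − t'` and `∫ (t'−s)^{-1/2} = 2√·`; away from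
`t'` use `T − s ≥ t' − s` and `∫ ds/(t'−s) = log(t'/(T−t')) ≤ log(T/(T−t'))`). So under Leray-rate
enstrophy `‖∇u(s)‖₂² ≤ C_Z (T−s)^{-1/2}` the enstrophy half-potential grows only logarithmically, and
the dynamic planar ceiling gives planar energies `O(log²(T/(T−t)))`. Elementary calculus.
-/

noncomputable section

-- single-conjunct summit: `Summit.<Summit>.<Problem>` repeats the name by the D-0017 layout
set_option linter.dupNamespace false

namespace Summit.NavierStokesRegularity.NavierStokesRegularity.Theorems.PlanarEnergyAPriori

open MeasureTheory Set Filter Topology Real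
open scoped ENNReal

/-- `∫_{(a,t')} (t'−s)^{-1/2} ds = 2√(t'−a)` in `ℝ≥0∞` form, for `a ≤ t'`. -/
theorem lintegral_Ioo_inv_sqrt_sub {a t' : ℝ} (ha : a ≤ t') :
    ∫⁻ s in Ioo a t', ENNReal.ofReal ((Real.sqrt (t' - s))⁻¹) = ENNReal.ofReal (2 * Real.sqrt (t' - a)) := by
  -- the integrand as an `rpow`
  have hpt : ∀ s ∈ Ioo a t', (Real.sqrt (t' - s))⁻¹ = (t' - s) ^ (-(1 / 2 : ℝ)) := fun s hs => by
    rw [Real.sqrt_eq_rpow, Real.rpow_neg (by linarith [hs.2])]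
  have hint : IntervalIntegrable (fun s => (t' - s) ^ (-(1 / 2 : ℝ))) volume a t' := by
    have h := (intervalIntegral.intervalIntegrable_rpow' (a := t' - a) (b := 0)
      (by norm_num : (-1 : ℝ) < -(1 / 2))).comp_sub_left t'
    simpa using h
  have hval : ∫ s in a..t', (t' - s) ^ (-(1 / 2 : ℝ)) = 2 * Real.sqrt (t' - a) := by
    rw [intervalIntegral.integral_comp_sub_left (fun x => x ^ (-(1 / 2 : ℝ))) t', sub_self,
      integral_rpow (Or.inl (by norm_num : (-1 : ℝ) < -(1 / 2)))]
    rw [Real.sqrt_eq_rpow]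
    norm_num
    ring
  have hnn : 0 ≤ᵐ[volume.restrict (Ioo a t')] fun s => (t' - s) ^ (-(1 / 2 : ℝ)) := by
    filter_upwards [ae_restrict_mem measurableSet_Ioo] with s hs
    exact Real.rpow_nonneg (by linarith [hs.2]) _
  have hint' : Integrable (fun s => (t' - s) ^ (-(1 / 2 : ℝ))) (volume.restrict (Ioo a t')) :=
    hint.1.mono_set Ioo_subset_Ioc_self
  calc ∫⁻ s in Ioo a t', ENNReal.ofReal ((Real.sqrt (t' - s))⁻¹)
      = ∫⁻ s in Ioo a t', ENNReal.ofReal ((t' - s) ^ (-(1 / 2 : ℝ))) :=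
        setLIntegral_congr_fun measurableSet_Ioo fun s hs => by rw [hpt s hs]
    _ = ENNReal.ofReal (∫ s in Ioo a t', (t' - s) ^ (-(1 / 2 : ℝ))) :=
        (ofReal_integral_eq_lintegral_ofReal hint' hnn).symm
    _ = ENNReal.ofReal (2 * Real.sqrt (t' - a)) := by
        rw [← hval, intervalIntegral.integral_of_le ha, integral_Ioc_eq_integral_Ioo]

/-- `∫_{(0,b]} ds/(t'−s) = log(t'/(t'−b))` in `ℝ≥0∞` form, for `0 ≤ b < t'`. -/
theorem lintegral_Ioc_inv_sub {b t' : ℝ} (hb : 0 ≤ b) (hbt : b < t') :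
    ∫⁻ s in Ioc 0 b, ENNReal.ofReal ((t' - s)⁻¹) = ENNReal.ofReal (Real.log (t' / (t' - b))) := by
  have ht' : 0 < t' := hb.trans_lt hbt
  have h0 : (0 : ℝ) ∉ uIcc (t' - b) (t' - 0) := by
    rw [sub_zero, uIcc_of_le (by linarith)]
    exact fun h => by linarith [h.1]
  have hval : ∫ s in (0 : ℝ)..b, (t' - s)⁻¹ = Real.log (t' / (t' - b)) := by
    rw [intervalIntegral.integral_comp_sub_left (fun x => x⁻¹) t', integral_inv h0, sub_zero]
  have hcont : ContinuousOn (fun s => (t' - s)⁻¹) (uIcc 0 b) := by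
    refine ContinuousOn.inv₀ (continuousOn_const.sub continuousOn_id) fun s hs => ?_
    rw [uIcc_of_le hb] at hs
    exact (by linarith [hs.2] : t' - s ≠ 0) |> fun h => h
  have hint : Integrable (fun s => (t' - s)⁻¹) (volume.restrict (Ioc 0 b)) :=
    (hcont.intervalIntegrable (μ := volume)).1
  have hnn : 0 ≤ᵐ[volume.restrict (Ioc 0 b)] fun s => (t' - s)⁻¹ := by
    filter_upwards [ae_restrict_mem measurableSet_Ioc] with s hs
    exact inv_nonneg.2 (by linarith [hs.2])
  rw [← ofReal_integral_eq_lintegral_ofReal hint hnn, ← intervalIntegral.integral_of_le hb, hval]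

/-- **The logarithmic kernel bound**: for `0 < t' < T`,
`∫_{(0,t')} (t'−s)^{-1/2}(T−s)^{-1/2} ds ≤ 2 + log(T/(T−t'))` (in `ℝ≥0∞`). -/
theorem lintegral_inv_sqrt_mul_inv_sqrt_le {t' T : ℝ} (ht' : 0 < t') (htT : t' < T) :
    ∫⁻ s in Ioo 0 t', ENNReal.ofReal ((Real.sqrt (t' - s))⁻¹) * ENNReal.ofReal ((Real.sqrt (T - s))⁻¹) ≤
      ENNReal.ofReal (2 + Real.log (T / (T - t'))) := by
  set τ : ℝ := T - t' with hτ
  have hτ0 : 0 < τ := by rw [hτ]; linarith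
  have hT0 : 0 < T := ht'.trans htT
  have hlog0 : 0 ≤ Real.log (T / (T - t')) := Real.log_nonneg (by rw [le_div_iff₀ (by linarith)]; linarith)
  -- pointwise bounds in the two regimes
  have hnear : ∀ s, s < t' → (Real.sqrt (t' - s))⁻¹ * (Real.sqrt (T - s))⁻¹ ≤
      (Real.sqrt τ)⁻¹ * (Real.sqrt (t' - s))⁻¹ := fun s hs => by
    rw [mul_comm]
    have h : (Real.sqrt (T - s))⁻¹ ≤ (Real.sqrt τ)⁻¹ :=
      inv_anti₀ (Real.sqrt_pos.2 hτ0) (Real.sqrt_le_sqrt (by rw [hτ]; linarith))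
    exact mul_le_mul_of_nonneg_right h (inv_nonneg.2 (Real.sqrt_nonneg _))
  have hfar : ∀ s, s ≤ t' - τ → (Real.sqrt (t' - s))⁻¹ * (Real.sqrt (T - s))⁻¹ ≤ (t' - s)⁻¹ := fun s hs => by
    have h1 : 0 < t' - s := by linarith
    have h : (Real.sqrt (T - s))⁻¹ ≤ (Real.sqrt (t' - s))⁻¹ :=
      inv_anti₀ (Real.sqrt_pos.2 h1) (Real.sqrt_le_sqrt (by linarith))
    calc (Real.sqrt (t' - s))⁻¹ * (Real.sqrt (T - s))⁻¹ ≤ (Real.sqrt (t' - s))⁻¹ * (Real.sqrt (t' - s))⁻¹ :=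
          mul_le_mul_of_nonneg_left h (inv_nonneg.2 (Real.sqrt_nonneg _))
      _ = (t' - s)⁻¹ := by rw [← mul_inv, Real.mul_self_sqrt h1.le]
  -- the near piece on any interval `(a, t')` with `t' - a ≤ τ`
  have hnearInt : ∀ a, t' - τ ≤ a → a ≤ t' →
      ∫⁻ s in Ioo a t', ENNReal.ofReal ((Real.sqrt (t' - s))⁻¹) * ENNReal.ofReal ((Real.sqrt (T - s))⁻¹) ≤ 2 := by
    intro a ha hat
    calc ∫⁻ s in Ioo a t', ENNReal.ofReal ((Real.sqrt (t' - s))⁻¹) * ENNReal.ofReal ((Real.sqrt (T - s))⁻¹)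
        ≤ ∫⁻ s in Ioo a t', ENNReal.ofReal ((Real.sqrt τ)⁻¹) * ENNReal.ofReal ((Real.sqrt (t' - s))⁻¹) := by
          refine setLIntegral_mono' measurableSet_Ioo fun s hs => ?_
          rw [← ENNReal.ofReal_mul (inv_nonneg.2 (Real.sqrt_nonneg _)),
            ← ENNReal.ofReal_mul (inv_nonneg.2 (Real.sqrt_nonneg _))]
          exact ENNReal.ofReal_le_ofReal (hnear s hs.2)
      _ = ENNReal.ofReal ((Real.sqrt τ)⁻¹) * ENNReal.ofReal (2 * Real.sqrt (t' - a)) := by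
          rw [lintegral_const_mul' _ _ ENNReal.ofReal_ne_top, lintegral_Ioo_inv_sqrt_sub hat]
      _ ≤ ENNReal.ofReal ((Real.sqrt τ)⁻¹) * ENNReal.ofReal (2 * Real.sqrt τ) := by
          gcongr; linarith
      _ = 2 := by
          rw [← ENNReal.ofReal_mul (inv_nonneg.2 (Real.sqrt_nonneg _)), ← ENNReal.ofReal_ofNat]
          congr 1
          field_simp [(Real.sqrt_pos.2 hτ0).ne']
  rcases le_or_gt t' τ with hsmall | hlarge
  · -- only the near regime
    calc _ ≤ (2 : ℝ≥0∞) := hnearInt 0 (by linarith) ht'.le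
      _ ≤ ENNReal.ofReal (2 + Real.log (T / (T - t'))) := by
          rw [← ENNReal.ofReal_ofNat]; exact ENNReal.ofReal_le_ofReal (by linarith)
  · -- split `(0, t') ⊆ (0, t'-τ] ∪ (t'-τ, t')`
    have hsub : Ioo 0 t' ⊆ Ioc 0 (t' - τ) ∪ Ioo (t' - τ) t' := fun s hs => by
      rcases le_or_gt s (t' - τ) with h | h
      · exact Or.inl ⟨hs.1, h⟩
      · exact Or.inr ⟨h, hs.2⟩
    have hfarInt : ∫⁻ s in Ioc 0 (t' - τ), ENNReal.ofReal ((Real.sqrt (t' - s))⁻¹) * ENNReal.ofReal ((Real.sqrt (T - s))⁻¹) ≤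
        ENNReal.ofReal (Real.log (T / (T - t'))) := by
      calc _ ≤ ∫⁻ s in Ioc 0 (t' - τ), ENNReal.ofReal ((t' - s)⁻¹) := by
            refine setLIntegral_mono' measurableSet_Ioc fun s hs => ?_
            rw [← ENNReal.ofReal_mul (inv_nonneg.2 (Real.sqrt_nonneg _))]
            exact ENNReal.ofReal_le_ofReal (hfar s hs.2)
        _ = ENNReal.ofReal (Real.log (t' / (t' - (t' - τ)))) := lintegral_Ioc_inv_sub (by linarith) (by linarith)
        _ ≤ ENNReal.ofReal (Real.log (T / (T - t'))) := by
            refine ENNReal.ofReal_le_ofReal (Real.log_le_log (div_pos ht' (by rw [sub_sub_cancel]; exact hτ0)) ?_)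
            rw [sub_sub_cancel, hτ]
            exact div_le_div_of_nonneg_right htT.le (by linarith)
    calc _ ≤ ∫⁻ s in Ioc 0 (t' - τ) ∪ Ioo (t' - τ) t', ENNReal.ofReal ((Real.sqrt (t' - s))⁻¹) * ENNReal.ofReal ((Real.sqrt (T - s))⁻¹) :=
          lintegral_mono_set hsub
      _ ≤ _ := lintegral_union_le _ _ _
      _ ≤ ENNReal.ofReal (Real.log (T / (T - t'))) + 2 := add_le_add hfarInt (hnearInt (t' - τ) le_rfl (by linarith))
      _ = ENNReal.ofReal (2 + Real.log (T / (T - t'))) := by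
          rw [add_comm, ENNReal.ofReal_add (by norm_num) hlog0, ENNReal.ofReal_ofNat]

/-- **The logarithmic kernel bound** (registered closed form, sub-goal `logKernelBound` of
stmt-NavierStokesRegularity-16855): for `0 < t' < T`,
`∫_{(0,t')} (t'−s)^{-1/2} (T−s)^{-1/2} ds ≤ 2 + log(T/(T−t'))` — the enstrophy half-potential of a
Leray-rate enstrophy `Z(s) ≤ C_Z (T−s)^{-1/2}` is `O(log(T/(T−t)))`, so the dynamic planar ceiling is
`O(log²)` in that class (strategist census gen 1, `TypeIEnstrophyLogSqCeiling`). [elementary] -/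
theorem logKernelBound : ∀ (t' T : ℝ), 0 < t' → t' < T → ∫⁻ s in Set.Ioo 0 t', ENNReal.ofReal ((Real.sqrt (t' - s))⁻¹) * ENNReal.ofReal ((Real.sqrt (T - s))⁻¹) ≤ ENNReal.ofReal (2 + Real.log (T / (T - t'))) :=
  fun _ _ ht' htT => lintegral_inv_sqrt_mul_inv_sqrt_le ht' htT

end Summit.NavierStokesRegularity.NavierStokesRegularity.Theorems.PlanarEnergyAPriori

end
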